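import Mathlib.Analysis.Calculus.ParametricIntegral
import Mathlib.Analysis.Calculus.MeanValue
import Literature.Probability.LatticeModels.GinibreInequality
import Literature.Probability.LatticeModels.GinibrePositiveKernels
import Literature.Probability.LatticeModels.PlaneRotatorTwistInequality
import Literature.Probability.LatticeModels.LebowitzInequality
import HarnessLib

/-!
# One-bond decoupling for Ginibre systems (generalised plane rotators)

The Ginibre-framework counterpart of `GKSBondDecoupling.lean` (which treats `±1` generalised Ising
systems by GKS): for a Gibbs measure `⟨·⟩_J ∝ exp(∑ₐ Jₐ Re χₐ) dμ` on a compact abelian group `Ω`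
with Haar probability `μ`, continuous unitary characters `χₐ` and couplings `Jₐ ≥ 0` (Ginibre 1970,
§2 Example 4 / Model 3: plane rotators, `U(1)` and `ℤ_n` lattice gauge theories), and a character
`χ₀` KILLED by switching off the couplings of a set `S` of terms (`⟨Re χ₀⟩_{J|S→0} = 0`, e.g. by a
one-link symmetry, `ginibreExpect_reChar_eq_zero_of_symmetry`), the ONE-BOND DECOUPLING INEQUALITY

  `⟨Re χ₀⟩_J ≤ ∑_{a ∈ S} Jₐ · ½ (⟨Re(χ₀ χₐ)⟩_J + ⟨Re(χ₀ χₐ⁻¹)⟩_J)`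

holds (`ginibreExpect_reChar_le_sum_decouple`). This is the `⟨W(C)⟩ ≤ β ∑_{P ∋ b} ⟨W(C) χ_P⟩` step of
Tomboulis–Ukawa–Windey 1981 / Sá Barreto–O'Carroll 1983 as restated by Mota–Sá Barreto 2024 §2
eq. (3), written for continuous (or discrete) abelian variables, where `Re χ₀ · Re χₐ =
½(Re(χ₀χₐ) + Re(χ₀χ̄ₐ))` replaces `σ_A σ_{C} = σ_{A∆C}`.

Proof as printed: along the path `t ↦ J_t` multiplying the couplings of `S` by `t ∈ [0,1]`
(tree `cplAt J S t`), `⟨Re χ₀⟩_0 = 0` and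

  `d/dt ⟨Re χ₀⟩_t = ⟨Re χ₀ · H_S⟩_t − ⟨Re χ₀⟩_t ⟨H_S⟩_t`,  `H_S = ∑_{a∈S} Jₐ Re χₐ`

(differentiation under the Haar integral, `hasDerivAt_ginibreExpect_cplAt`; Ginibre 1970 §1 (1.7)–(1.8):
the covariance `⟨fg⟩ − ⟨f⟩⟨g⟩`), `≤ ⟨Re χ₀ H_S⟩_t` by Griffiths' first inequality (both factors of the
subtracted product are `≥ 0`), `= ∑ₐ Jₐ ½(⟨Re(χ₀χₐ)⟩_t + ⟨Re(χ₀χₐ⁻¹)⟩_t) ≤` the same at `t = 1` by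
Ginibre's comparison inequality (tree `ginibreExpect_reChar_mono`, which needs every element of `Ω`
to be a square), and the mean value inequality on `[0,1]`.

## Main results (sorry-free, no new facts)

* `ginibreHamiltonian_cplAt`, `hasDerivAt_integral_mul_ginibreWeight_cplAt`,
  `hasDerivAt_ginibreExpect_cplAt`: the fluctuation (covariance) formula for `d/dt ⟨F⟩_{J_t}`.
* `ginibreExpect_add`, `ginibreExpect_const_mul`, `ginibreExpect_sum_mul`: linearity in the observable.
* `ginibreExpect_reChar_eq_zero_of_symmetry`: if `g ∈ Ω` fixes every coupled character
  (`Kₐ = 0 ∨ χₐ(g) = 1`) but `χ₀(g) ≠ 1`, then `⟨Re χ₀⟩_K = 0` (Haar invariance).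
* `ginibreExpect_reChar_le_sum_decouple`, `ginibreExpect_reChar_le_mul_sum_decouple` (uniform `β`).

## References

* [Ginibre1970] J. Ginibre, General formulation of Griffiths' inequalities, Commun. Math. Phys. 16
  (1970) 310–328 — §1 (1.7)–(1.8), Props. 2–3, §2 Example 4, Model 3.
* [MotaSaBarreto2024] A. L. Mota, F. C. Sá Barreto, arXiv:2402.12277, §2 eq. (3).
* [TomboulisUkawaWindey1981] Nucl. Phys. B 180 (1981) 294.
-/

noncomputable section

open MeasureTheory Filter Finset
open scoped Topology

namespace Literature.Probability.LatticeModels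

variable {Ω : Type*} [CommGroup Ω] [TopologicalSpace Ω] [IsTopologicalGroup Ω] [CompactSpace Ω]
  [SecondCountableTopology Ω] [MeasurableSpace Ω] [BorelSpace Ω] {ι : Type*} [Fintype ι] [DecidableEq ι]

/-! ### §1 Linearity of the Gibbs expectation in the observable -/

section Linear

variable (μ : Measure Ω) [IsProbabilityMeasure μ] (χ : ι → Ω →ₜ* Circle) (K : ι → ℝ)

omit [IsTopologicalGroup Ω] [SecondCountableTopology Ω] [DecidableEq ι] in
/-- `⟨f + g⟩_K = ⟨f⟩_K + ⟨g⟩_K` for continuous `f, g` (the thermal average (1.7) is linear).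
[cite: Ginibre1970, §1 eq. (1.7) (definition of the thermal average ⟨f⟩_h)] -/
theorem ginibreExpect_add {f g : Ω → ℝ} (hf : Continuous f) (hg : Continuous g) :
    ginibreExpect μ χ K (fun θ => f θ + g θ) = ginibreExpect μ χ K f + ginibreExpect μ χ K g := by
  unfold ginibreExpect
  rw [← add_div]
  congr 1
  simp_rw [add_mul]
  exact integral_add (integrable_of_continuous_compactSpace μ (hf.mul (continuous_ginibreWeight χ K)))
    (integrable_of_continuous_compactSpace μ (hg.mul (continuous_ginibreWeight χ K)))

omit [IsTopologicalGroup Ω] [CompactSpace Ω] [SecondCountableTopology Ω] [BorelSpace Ω] [DecidableEq ι]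
  [IsProbabilityMeasure μ] in
/-- `⟨c f⟩_K = c ⟨f⟩_K`. [cite: Ginibre1970, §1 eq. (1.7) (definition of the thermal average ⟨f⟩_h)] -/
theorem ginibreExpect_const_mul (c : ℝ) (f : Ω → ℝ) :
    ginibreExpect μ χ K (fun θ => c * f θ) = c * ginibreExpect μ χ K f := by
  unfold ginibreExpect
  simp_rw [mul_assoc]
  rw [integral_const_mul, mul_div_assoc]

omit [IsTopologicalGroup Ω] [SecondCountableTopology Ω] [DecidableEq ι] in
/-- `⟨∑ₖ cₖ gₖ⟩_K = ∑ₖ cₖ ⟨gₖ⟩_K` for continuous `gₖ`. [cite: Ginibre1970, §1 eq. (1.7) (definition of the thermal average ⟨f⟩_h)] -/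
theorem ginibreExpect_sum_mul {κ : Type*} (s : Finset κ) (c : κ → ℝ) {g : κ → Ω → ℝ}
    (hg : ∀ k, Continuous (g k)) :
    ginibreExpect μ χ K (fun θ => ∑ k ∈ s, c k * g k θ) = ∑ k ∈ s, c k * ginibreExpect μ χ K (g k) := by
  unfold ginibreExpect
  have hint : ∀ k, Integrable (fun θ => g k θ * ginibreWeight χ K θ) μ := fun k =>
    integrable_of_continuous_compactSpace μ ((hg k).mul (continuous_ginibreWeight χ K))
  have h : ∫ θ, (∑ k ∈ s, c k * g k θ) * ginibreWeight χ K θ ∂μ =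
      ∑ k ∈ s, c k * ∫ θ, g k θ * ginibreWeight χ K θ ∂μ := by
    have e : ∀ θ, (∑ k ∈ s, c k * g k θ) * ginibreWeight χ K θ =
        ∑ k ∈ s, c k * (g k θ * ginibreWeight χ K θ) := fun θ => by
      rw [Finset.sum_mul]
      exact Finset.sum_congr rfl fun k _ => mul_assoc _ _ _
    simp_rw [e]
    rw [integral_finsetSum _ fun k _ => (hint k).const_mul (c k)]
    exact Finset.sum_congr rfl fun k _ => integral_const_mul _ _
  rw [h, Finset.sum_div]
  exact Finset.sum_congr rfl fun k _ => mul_div_assoc _ _ _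

end Linear

/-! ### §2 Characters killed by a symmetry of the couplings -/

section Symmetry

omit [CommGroup Ω] [IsTopologicalGroup Ω] [SecondCountableTopology Ω] in
/-- A continuous complex function on a compact probability space is integrable. [folklore] -/
private theorem integrable_complex_of_continuous (μ : Measure Ω) [IsFiniteMeasure μ] {f : Ω → ℂ}
    (hf : Continuous f) : Integrable f μ := by
  obtain ⟨C, hC⟩ := isCompact_univ.exists_bound_of_continuousOn hf.continuousOn
  exact Integrable.of_bound hf.aestronglyMeasurable C (ae_of_all _ fun x => hC x (Set.mem_univ x))

variable (μ : Measure Ω) [IsProbabilityMeasure μ] [μ.IsMulLeftInvariant] (χ : ι → Ω →ₜ* Circle)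

omit [SecondCountableTopology Ω] [DecidableEq ι] in
/-- **A symmetry of the couplings kills non-invariant characters.** If `g ∈ Ω` fixes every coupled
character (`Kₐ = 0` or `χₐ(g) = 1` for each `a`) and `χ₀(g) ≠ 1`, then `⟨Re χ₀⟩_K = 0`: the
translation `θ ↦ gθ` preserves the Haar measure and the Gibbs weight and multiplies `χ₀` by
`χ₀(g) ≠ 1`. (For a lattice gauge theory: rotating one link variable by a group element kills every
loop character with non-trivial charge on that link once the plaquettes through it are switched off —
the abelian form of the "flip one spin" step of the TUW decoupling argument.)
[cite: MotaSaBarreto2024, §2 (text before eq. (3): the expectation vanishes when the plaquettes containing the bond are removed)] -/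
theorem ginibreExpect_reChar_eq_zero_of_symmetry (K : ι → ℝ) (χ₀ : Ω →ₜ* Circle) {g : Ω}
    (hK : ∀ a, K a = 0 ∨ χ a g = 1) (hg : χ₀ g ≠ 1) : ginibreExpect μ χ K (reChar χ₀) = 0 := by
  have hw : ∀ θ, ginibreWeight χ K (g * θ) = ginibreWeight χ K θ := by
    intro θ
    simp only [ginibreWeight, ginibreHamiltonian]
    congr 1
    refine Finset.sum_congr rfl fun a _ => ?_
    rcases hK a with h | h
    · rw [h, zero_mul, zero_mul]
    · rw [reChar, reChar, map_mul, h, one_mul]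
  set I : ℂ := ∫ θ, ((χ₀ θ : Circle) : ℂ) * (ginibreWeight χ K θ : ℂ) ∂μ with hI
  have hcont : Continuous fun θ => ((χ₀ θ : Circle) : ℂ) * (ginibreWeight χ K θ : ℂ) :=
    (continuous_subtype_val.comp (map_continuous χ₀)).mul
      (Complex.continuous_ofReal.comp (continuous_ginibreWeight χ K))
  have hinv : I = ((χ₀ g : Circle) : ℂ) * I := by
    rw [hI, ← integral_const_mul, ← integral_mul_left_eq_self _ g]
    refine integral_congr_ae (ae_of_all _ fun θ => ?_)
    simp only [map_mul, Circle.coe_mul, hw θ]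
    ring
  have hI0 : I = 0 := by
    have h1 : (1 - ((χ₀ g : Circle) : ℂ)) * I = 0 := by rw [sub_mul, one_mul, ← hinv, sub_self]
    rcases mul_eq_zero.1 h1 with h | h
    · exfalso
      apply hg
      have h' : ((χ₀ g : Circle) : ℂ) = ((1 : Circle) : ℂ) := by
        rw [Circle.coe_one]
        exact (sub_eq_zero.1 h).symm
      exact Circle.coe_inj.1 h'
    · exact h
  have hre : ∫ θ, reChar χ₀ θ * ginibreWeight χ K θ ∂μ = I.re := by
    have h := integral_re (integrable_complex_of_continuous μ hcont)
    simp only [RCLike.re_to_complex] at h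
    rw [hI, ← h]
    refine integral_congr_ae (ae_of_all _ fun θ => ?_)
    simp [reChar, Complex.mul_re]
  rw [ginibreExpect, hre, hI0, Complex.zero_re, zero_div]

end Symmetry

/-! ### §3 The coupling path and the fluctuation formula -/

section Calculus

variable (μ : Measure Ω) [IsProbabilityMeasure μ] (χ : ι → Ω →ₜ* Circle) (J : ι → ℝ) (S : Finset ι)

omit [IsTopologicalGroup Ω] [CompactSpace Ω] [SecondCountableTopology Ω] [MeasurableSpace Ω]
  [BorelSpace Ω] in
/-- Along the coupling path the Hamiltonian is affine in `t`: `H_{J_t} = H_{J|S→0} + t H_S`.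
[cite: MotaSaBarreto2024, §2 (proof of eq. (3): the interpolating couplings)] -/
theorem ginibreHamiltonian_cplAt (t : ℝ) (θ : Ω) :
    ginibreHamiltonian χ (cplAt J S t) θ =
      ginibreHamiltonian χ (cplOff J S) θ + t * ginibreHamiltonian χ (cplOn J S) θ := by
  simp only [ginibreHamiltonian, Finset.mul_sum, ← Finset.sum_add_distrib]
  refine Finset.sum_congr rfl fun a _ => ?_
  rw [cplAt_eq]
  ring

omit [IsTopologicalGroup Ω] [CompactSpace Ω] [SecondCountableTopology Ω] [MeasurableSpace Ω] [BorelSpace Ω] in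
/-- Pointwise `t`-derivative of the Gibbs weight along the path. [folklore] -/
private theorem hasDerivAt_ginibreWeight_cplAt (θ : Ω) (t : ℝ) :
    HasDerivAt (fun x => ginibreWeight χ (cplAt J S x) θ)
      (ginibreHamiltonian χ (cplOn J S) θ * ginibreWeight χ (cplAt J S t) θ) t := by
  have h1 : HasDerivAt (fun x : ℝ => ginibreHamiltonian χ (cplOff J S) θ + x * ginibreHamiltonian χ (cplOn J S) θ)
      (ginibreHamiltonian χ (cplOn J S) θ) t := by
    simpa using ((hasDerivAt_id t).mul_const (ginibreHamiltonian χ (cplOn J S) θ)).const_add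
      (ginibreHamiltonian χ (cplOff J S) θ)
  have h2 := h1.exp
  have e : (fun x => ginibreWeight χ (cplAt J S x) θ) =
      fun x => Real.exp (ginibreHamiltonian χ (cplOff J S) θ + x * ginibreHamiltonian χ (cplOn J S) θ) := by
    funext x; rw [ginibreWeight, ginibreHamiltonian_cplAt]
  rw [e, ginibreWeight, ginibreHamiltonian_cplAt, mul_comm]
  exact h2

omit [IsTopologicalGroup Ω] [CompactSpace Ω] [SecondCountableTopology Ω] [MeasurableSpace Ω] [BorelSpace Ω] in
/-- Joint continuity of the weight in `(t, θ)`. [folklore] -/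
private theorem continuous_ginibreWeight_cplAt_uncurry :
    Continuous fun p : ℝ × Ω => ginibreWeight χ (cplAt J S p.1) p.2 := by
  have e : (fun p : ℝ × Ω => ginibreWeight χ (cplAt J S p.1) p.2) =
      fun p => Real.exp (ginibreHamiltonian χ (cplOff J S) p.2 + p.1 * ginibreHamiltonian χ (cplOn J S) p.2) := by
    funext p; rw [ginibreWeight, ginibreHamiltonian_cplAt]
  rw [e]
  exact Real.continuous_exp.comp (((continuous_ginibreHamiltonian χ _).comp continuous_snd).add
    (continuous_fst.mul ((continuous_ginibreHamiltonian χ _).comp continuous_snd)))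

omit [IsTopologicalGroup Ω] [SecondCountableTopology Ω] in
/-- **Differentiation under the Haar integral along the coupling path**:
`d/dt ∫ F e^{H_{J_t}} dμ = ∫ F H_S e^{H_{J_t}} dμ` for continuous `F` (the derivative of the
integrand is continuous on the compact set `closedBall t 1 × Ω`, hence dominated by a constant).
[cite: Ginibre1970, §1 eqs. (1.7)–(1.8) (thermal averages and the covariance ⟨fg⟩ − ⟨f⟩⟨g⟩)] -/
theorem hasDerivAt_integral_mul_ginibreWeight_cplAt {F : Ω → ℝ} (hF : Continuous F) (t₀ : ℝ) :
    HasDerivAt (fun t => ∫ θ, F θ * ginibreWeight χ (cplAt J S t) θ ∂μ)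
      (∫ θ, F θ * ginibreHamiltonian χ (cplOn J S) θ * ginibreWeight χ (cplAt J S t₀) θ ∂μ) t₀ := by
  have hW := continuous_ginibreWeight_cplAt_uncurry χ J S
  have hF' : Continuous fun p : ℝ × Ω =>
      F p.2 * ginibreHamiltonian χ (cplOn J S) p.2 * ginibreWeight χ (cplAt J S p.1) p.2 :=
    ((hF.comp continuous_snd).mul ((continuous_ginibreHamiltonian χ _).comp continuous_snd)).mul hW
  have hFt : ∀ t, Continuous fun θ => F θ * ginibreWeight χ (cplAt J S t) θ := fun t =>
    hF.mul (continuous_ginibreWeight χ _)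
  have hF't : ∀ t, Continuous fun θ =>
      F θ * ginibreHamiltonian χ (cplOn J S) θ * ginibreWeight χ (cplAt J S t) θ := fun t =>
    (hF.mul (continuous_ginibreHamiltonian χ _)).mul (continuous_ginibreWeight χ _)
  obtain ⟨C, hC⟩ := ((isCompact_closedBall t₀ 1).prod isCompact_univ).exists_bound_of_continuousOn
    hF'.continuousOn
  have h := hasDerivAt_integral_of_dominated_loc_of_deriv_le (μ := μ)
    (F := fun t θ => F θ * ginibreWeight χ (cplAt J S t) θ)
    (F' := fun t θ => F θ * ginibreHamiltonian χ (cplOn J S) θ * ginibreWeight χ (cplAt J S t) θ)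
    (x₀ := t₀) (s := Metric.ball t₀ 1) (bound := fun _ => C) (Metric.ball_mem_nhds t₀ one_pos)
    (Eventually.of_forall fun t => (hFt t).aestronglyMeasurable)
    (integrable_of_continuous_compactSpace μ (hFt t₀)) (hF't t₀).aestronglyMeasurable
    (ae_of_all _ fun θ t ht => hC (t, θ) (Set.mk_mem_prod (Metric.ball_subset_closedBall ht) (Set.mem_univ θ)))
    (integrable_const C)
    (ae_of_all _ fun θ t _ => ((hasDerivAt_ginibreWeight_cplAt χ J S θ t).const_mul (F θ)).congr_deriv
      (by ring))
  exact h.2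

omit [IsTopologicalGroup Ω] [SecondCountableTopology Ω] in
/-- **The fluctuation formula** (Ginibre 1970 (1.8): the covariance is the derivative of the thermal
average in a coupling): along the path `J_t = cplAt J S t`, for continuous `F`,

  `d/dt ⟨F⟩_{J_t} = ⟨F · H_S⟩_{J_t} − ⟨F⟩_{J_t} ⟨H_S⟩_{J_t}`,  `H_S = ∑_{a ∈ S} Jₐ Re χₐ`.

[cite: Ginibre1970, §1 eqs. (1.7)–(1.8) (thermal averages and the covariance ⟨fg⟩ − ⟨f⟩⟨g⟩)] -/
theorem hasDerivAt_ginibreExpect_cplAt {F : Ω → ℝ} (hF : Continuous F) (t : ℝ) :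
    HasDerivAt (fun x => ginibreExpect μ χ (cplAt J S x) F)
      (ginibreExpect μ χ (cplAt J S t) (fun θ => F θ * ginibreHamiltonian χ (cplOn J S) θ) -
        ginibreExpect μ χ (cplAt J S t) F *
          ginibreExpect μ χ (cplAt J S t) (ginibreHamiltonian χ (cplOn J S))) t := by
  have hN := hasDerivAt_integral_mul_ginibreWeight_cplAt μ χ J S hF t
  have hD := hasDerivAt_integral_mul_ginibreWeight_cplAt μ χ J S (F := fun _ => (1 : ℝ)) continuous_const t
  simp only [one_mul] at hD
  have hZ : 0 < ∫ θ, ginibreWeight χ (cplAt J S t) θ ∂μ :=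
    integral_exp_pos (integrable_of_continuous_compactSpace μ (continuous_ginibreWeight χ _))
  have hq := hN.div hD hZ.ne'
  have e : (fun x => ginibreExpect μ χ (cplAt J S x) F) =
      fun x => (∫ θ, F θ * ginibreWeight χ (cplAt J S x) θ ∂μ) / ∫ θ, ginibreWeight χ (cplAt J S x) θ ∂μ := by
    funext x; rfl
  rw [e]
  refine hq.congr_deriv ?_
  simp only [ginibreExpect]
  field_simp

end Calculus

/-! ### §4 The one-bond decoupling inequality -/

section Decouple

omit [IsTopologicalGroup Ω] [CompactSpace Ω] [SecondCountableTopology Ω] [MeasurableSpace Ω] [BorelSpace Ω] in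
/-- `Re χ₀ · Re χ₁ = ½ (Re(χ₀χ₁) + Re(χ₀χ₁⁻¹))` (product-to-sum for unitary characters).
[folklore] -/
private theorem reChar_mul_reChar (χ₀ χ₁ : Ω →ₜ* Circle) (θ : Ω) :
    reChar χ₀ θ * reChar χ₁ θ = (reChar (χ₀ * χ₁) θ + reChar (χ₀ * χ₁⁻¹) θ) / 2 := by
  have hmul : (χ₀ * χ₁) θ = χ₀ θ * χ₁ θ := rfl
  have hinv : (χ₀ * χ₁⁻¹) θ = χ₀ θ * (χ₁ θ)⁻¹ := rfl
  simp only [reChar, hmul, hinv, Circle.coe_mul, Circle.coe_inv_eq_conj, Complex.mul_re, Complex.conj_re,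
    Complex.conj_im]
  ring

/-- **ONE-BOND DECOUPLING FOR GINIBRE SYSTEMS** (Tomboulis–Ukawa–Windey 1981 / Sá Barreto–O'Carroll
1983, in the form of Mota–Sá Barreto 2024 §2 eq. (3), for generalised plane rotators). Let `μ` be a
Haar probability measure on a compact abelian group `Ω` in which every element is a square,
`χₐ` continuous unitary characters with couplings `Jₐ ≥ 0`, `S` a set of terms and `χ₀` a character
with `⟨Re χ₀⟩_{J|S→0} = 0`. Then

  `⟨Re χ₀⟩_J ≤ ∑_{a ∈ S} Jₐ · (⟨Re(χ₀χₐ)⟩_J + ⟨Re(χ₀χₐ⁻¹)⟩_J) / 2`.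

Proof as printed: `d/dt ⟨Re χ₀⟩_{J_t} = ∑_{a∈S} Jₐ (⟨Re χ₀ Re χₐ⟩_t − ⟨Re χ₀⟩_t⟨Re χₐ⟩_t)
≤ ∑ₐ Jₐ ⟨Re χ₀ Re χₐ⟩_t ≤ ∑ₐ Jₐ ⟨Re χ₀ Re χₐ⟩_J` (Griffiths I and Ginibre's comparison inequality),
integrated over `[0, 1]`. [cite: MotaSaBarreto2024, §2 eq. (3)] -/
theorem ginibreExpect_reChar_le_sum_decouple (μ : Measure Ω) [μ.IsHaarMeasure] [IsProbabilityMeasure μ]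
    (h2 : Function.Surjective fun ψ : Ω => ψ * ψ) (χ : ι → Ω →ₜ* Circle) {J : ι → ℝ}
    (hJ : ∀ a, 0 ≤ J a) (S : Finset ι) (χ₀ : Ω →ₜ* Circle)
    (h0 : ginibreExpect μ χ (cplOff J S) (reChar χ₀) = 0) :
    ginibreExpect μ χ J (reChar χ₀) ≤ ∑ a ∈ S, J a *
      ((ginibreExpect μ χ J (reChar (χ₀ * χ a)) + ginibreExpect μ χ J (reChar (χ₀ * (χ a)⁻¹))) / 2) := by
  set M : ℝ := ∑ a ∈ S, J a *
    ((ginibreExpect μ χ J (reChar (χ₀ * χ a)) + ginibreExpect μ χ J (reChar (χ₀ * (χ a)⁻¹))) / 2) with hM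
  set Φ : ℝ → ℝ := fun t => ginibreExpect μ χ (cplAt J S t) (reChar χ₀) with hΦ
  set Φ' : ℝ → ℝ := fun t =>
    ginibreExpect μ χ (cplAt J S t) (fun θ => reChar χ₀ θ * ginibreHamiltonian χ (cplOn J S) θ) -
      ginibreExpect μ χ (cplAt J S t) (reChar χ₀) *
        ginibreExpect μ χ (cplAt J S t) (ginibreHamiltonian χ (cplOn J S)) with hΦ'
  have hder : ∀ t, HasDerivAt Φ (Φ' t) t := fun t =>
    hasDerivAt_ginibreExpect_cplAt μ χ J S (continuous_reChar χ₀) t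
  have hOn : ∀ a, 0 ≤ cplOn J S a := fun a => by
    unfold cplOn; split_ifs; exacts [hJ a, le_rfl]
  -- the derivative is bounded by `M` on `[0, 1]`
  have hbound : ∀ t, 0 ≤ t → t ≤ 1 → Φ' t ≤ M := by
    intro t ht0 ht1
    have hKt : ∀ a, 0 ≤ cplAt J S t a := fun a =>
      cplAt_nonneg Finset.univ J S (fun a _ => hJ a) ht0 a (Finset.mem_univ a)
    have hKle : ∀ a, cplAt J S t a ≤ J a := fun a =>
      le_of_abs_le (abs_cplAt_le Finset.univ J S (fun a _ => hJ a) ht0 ht1 a (Finset.mem_univ a))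
    have hG : ginibreExpect μ χ (cplAt J S t) (ginibreHamiltonian χ (cplOn J S)) =
        ∑ a, cplOn J S a * ginibreExpect μ χ (cplAt J S t) (reChar (χ a)) := by
      rw [← ginibreExpect_sum_mul μ χ (cplAt J S t) Finset.univ (cplOn J S) fun a => continuous_reChar (χ a)]
      rfl
    have hprod : 0 ≤ ginibreExpect μ χ (cplAt J S t) (reChar χ₀) *
        ginibreExpect μ χ (cplAt J S t) (ginibreHamiltonian χ (cplOn J S)) := by
      refine mul_nonneg (ginibreExpect_reChar_nonneg_dual μ χ hKt χ₀) ?_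
      rw [hG]
      exact Finset.sum_nonneg fun a _ => mul_nonneg (hOn a) (ginibreExpect_reChar_nonneg_dual μ χ hKt (χ a))
    have hE1 : ginibreExpect μ χ (cplAt J S t) (fun θ => reChar χ₀ θ * ginibreHamiltonian χ (cplOn J S) θ) =
        ∑ a, cplOn J S a * ginibreExpect μ χ (cplAt J S t) (fun θ => reChar χ₀ θ * reChar (χ a) θ) := by
      rw [← ginibreExpect_sum_mul μ χ (cplAt J S t) Finset.univ (cplOn J S)
        (g := fun a θ => reChar χ₀ θ * reChar (χ a) θ)
        fun a => (continuous_reChar χ₀).mul (continuous_reChar (χ a))]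
      congr 1
      funext θ
      rw [ginibreHamiltonian, Finset.mul_sum]
      exact Finset.sum_congr rfl fun a _ => by ring
    have hE2 : ∀ a, ginibreExpect μ χ (cplAt J S t) (fun θ => reChar χ₀ θ * reChar (χ a) θ) =
        (ginibreExpect μ χ (cplAt J S t) (reChar (χ₀ * χ a)) +
          ginibreExpect μ χ (cplAt J S t) (reChar (χ₀ * (χ a)⁻¹))) / 2 := by
      intro a
      have e : (fun θ => reChar χ₀ θ * reChar (χ a) θ) =
          fun θ => (1 / 2) * (reChar (χ₀ * χ a) θ + reChar (χ₀ * (χ a)⁻¹) θ) := by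
        funext θ; rw [reChar_mul_reChar]; ring
      rw [e, ginibreExpect_const_mul, ginibreExpect_add μ χ _ (continuous_reChar _) (continuous_reChar _)]
      ring
    have hmono : ∀ ψ : Ω →ₜ* Circle,
        ginibreExpect μ χ (cplAt J S t) (reChar ψ) ≤ ginibreExpect μ χ J (reChar ψ) := fun ψ =>
      ginibreExpect_reChar_mono μ h2 χ ψ hKt hKle
    calc Φ' t ≤ ginibreExpect μ χ (cplAt J S t) (fun θ => reChar χ₀ θ * ginibreHamiltonian χ (cplOn J S) θ) :=
          sub_le_self _ hprod
      _ = ∑ a, cplOn J S a * ((ginibreExpect μ χ (cplAt J S t) (reChar (χ₀ * χ a)) +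
            ginibreExpect μ χ (cplAt J S t) (reChar (χ₀ * (χ a)⁻¹))) / 2) := by
          rw [hE1]
          exact Finset.sum_congr rfl fun a _ => by rw [hE2]
      _ ≤ ∑ a, cplOn J S a * ((ginibreExpect μ χ J (reChar (χ₀ * χ a)) +
            ginibreExpect μ χ J (reChar (χ₀ * (χ a)⁻¹))) / 2) := by
          refine Finset.sum_le_sum fun a _ => mul_le_mul_of_nonneg_left ?_ (hOn a)
          have h₁ := hmono (χ₀ * χ a)
          have h₂ := hmono (χ₀ * (χ a)⁻¹)
          linarith
      _ = M := by
          rw [hM]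
          have e : ∀ a, cplOn J S a * ((ginibreExpect μ χ J (reChar (χ₀ * χ a)) +
              ginibreExpect μ χ J (reChar (χ₀ * (χ a)⁻¹))) / 2) =
              if a ∈ S then J a * ((ginibreExpect μ χ J (reChar (χ₀ * χ a)) +
                ginibreExpect μ χ J (reChar (χ₀ * (χ a)⁻¹))) / 2) else 0 := fun a => by
            unfold cplOn; split_ifs <;> simp
          rw [Finset.sum_congr rfl fun a _ => e a, Finset.sum_ite_mem, Finset.univ_inter]
  -- mean value inequality on `[0, 1]`
  have hdiff : Differentiable ℝ Φ := fun t => (hder t).differentiableAt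
  have hderiv_le : ∀ t ∈ interior (Set.Icc (0 : ℝ) 1), deriv Φ t ≤ M := by
    intro t ht
    rw [interior_Icc] at ht
    rw [(hder t).deriv]
    exact hbound t ht.1.le ht.2.le
  have hmvt := (convex_Icc (0 : ℝ) 1).image_sub_le_mul_sub_of_deriv_le hdiff.continuous.continuousOn
    hdiff.differentiableOn hderiv_le 0 (Set.left_mem_Icc.2 zero_le_one) 1
    (Set.right_mem_Icc.2 zero_le_one) zero_le_one
  have h1 : Φ 1 = ginibreExpect μ χ J (reChar χ₀) := by simp only [hΦ, cplAt_one]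
  have h0' : Φ 0 = 0 := by simp only [hΦ, cplAt_zero]; exact h0
  rw [h1, h0'] at hmvt
  norm_num at hmvt
  exact hmvt

/-- The one-bond decoupling inequality for a **uniform** coupling `β ≥ 0` (the printed form
`⟨W(C)⟩ ≤ β ∑_{P ∋ b} ⟨W(C) χ_P⟩`, abelian variables):
`⟨Re χ₀⟩_β ≤ β ∑_{a∈S} (⟨Re(χ₀χₐ)⟩_β + ⟨Re(χ₀χₐ⁻¹)⟩_β)/2`. [cite: MotaSaBarreto2024, §2 eq. (3)] -/
theorem ginibreExpect_reChar_le_mul_sum_decouple (μ : Measure Ω) [μ.IsHaarMeasure] [IsProbabilityMeasure μ]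
    (h2 : Function.Surjective fun ψ : Ω => ψ * ψ) (χ : ι → Ω →ₜ* Circle) {β : ℝ} (hβ : 0 ≤ β)
    (S : Finset ι) (χ₀ : Ω →ₜ* Circle)
    (h0 : ginibreExpect μ χ (cplOff (fun _ => β) S) (reChar χ₀) = 0) :
    ginibreExpect μ χ (fun _ => β) (reChar χ₀) ≤ β * ∑ a ∈ S,
      (ginibreExpect μ χ (fun _ => β) (reChar (χ₀ * χ a)) +
        ginibreExpect μ χ (fun _ => β) (reChar (χ₀ * (χ a)⁻¹))) / 2 := by
  rw [Finset.mul_sum]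
  exact ginibreExpect_reChar_le_sum_decouple μ h2 χ (fun _ => hβ) S χ₀ h0

end Decouple

end Literature.Probability.LatticeModels

end
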